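import Summits.CriticalPhenomena.SAWScalingLimit.Theorems.AnnularMassDecay.Negative.LoadBearing
import Summits.CriticalPhenomena.SAWScalingLimit.Theorems.SAWRenewalTightnessAnnularMassDecayChainInduction

/-!
# `stub_chainDecay`: the renewal-inequality induction (S4 → S1 → S2 → S3 → ChainDecay)

Line `radial-renewal-kesten-inequality` of the crux `AnnularMassDecay` (stmt-CriticalPhenomena-4729),
stub S5, registered verbatim in `Cruxes/AnnularMassDecay/Lines/radial-renewal-kesten-inequality.lean`.
Write `ρ_u = dist (Site.toComplex u) z` and `D(u;s)[N]` for the `x_c`-mass of the chain-stopped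
family at level `s` from `u` (self-avoiding `ω` of length `0 < n ≤ N`, confined to the open disc of
radius `ρ_u` about `z` after time `0`, ending at a strict radial record of radius `≤ s`, none of whose
radial renewal times `0 < t < n` has radius `≤ s`).  The four hypotheses are the statements of the
line's other stubs — the first-`A`-descent factorisation `D(u;s)[N] ≤ Σ_η x_c^{|η|} D(u+η_m;s)[N] +
Skip(u;A,s)[N]` (`s < ρ_u/A`), boundedness `D(u;s)[N] ≤ K₀` (`s ≥ 1`), the death seed
`D(u;ρ_u/A)[N] ≤ 1 - ε`, and the skip tail `Skip(u;A,ρ_u/(AB))[N] ≤ C B^{-κ}` (`1 ≤ B`,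
`A B ≤ ρ_u`) — and the conclusion is `ChainDecay`: `D(u;r)[N] ≤ C (r/ρ_u)^θ` for `1 ≤ r < ρ_u`,
with `θ > 0`.  All sums are spelled out over `SAW.Zd.saws`, `SAW.criticalFugacity`,
`Site.toComplex`; no definitions here.

Proof.  `rr_cd_abstract_chainDecay` (registered helper) is the same implication for an ARBITRARY
family `S n` of finite sets of paths, weight `x ≥ 0` and radius function `R : Site 2 → ℝ` (one
centre), with the constants `A, ε, κ, Cs, K₀` fixed first so that `θ, C` depend on them alone: for
a fixed truncation `N` the masses `(u, s) ↦ D(u;s)[N]` satisfy the hypotheses of the abstract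
induction `rr_decay_of_renewal_inequality` (`Theorems/SAWRenewalTightnessAnnularMassDecayChainInduction.lean`)
— the children of `(u, s)` are the prefixes `η` of the factorisation (weights `x^{|η|}`, landing
points `u + η_m` of radius `≤ R u/A`), their total weight is at most `D(u;R u/A)[N] ≤ 1 - ε`, the
weight landing at radius `≤ R u/(AB)` is a skip mass `≤ Cs B^{-κ}`, and the skip term of the
factorisation is the skip tail at `B = R u/(As)`.  `stub_chainDecay` is the instance
`S = SAW.Zd.saws 2`, `x = x_c`, `R = dist (Site.toComplex ·) z`, centre by centre.
Sources: W. Feller, *An Introduction to Probability Theory* II, ch. XIII; N. Madras, G. Slade,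
*The Self-Avoiding Walk* (1993), §4.2 and App. A. [folklore]
-/

noncomputable section

namespace Summit.CriticalPhenomena.SAWScalingLimit.Theorems.AnnularMassDecay.Radial

open scoped BigOperators Classical
open Literature.Probability.LatticeModels Literature.Probability.RandomPlanarGeometry
open Summit.CriticalPhenomena.SAWScalingLimit.Theorems.AnnularMassDecay.Negative (criticalFugacity_pos)

/-- **Abstract chain decay** (registered helper for `stub_chainDecay`).  For paths `ω ∈ S n` with
weight `x^n` (`x ≥ 0`), starts `u : Site 2` and a radius function `R`, write `D(u;s)[N]` for the
weighted count of the level-`s` chain-stopped members of length `n ≤ N` (`0 < n`, radii `< R u` after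
time `0`, end a strict radial record of radius `≤ s`, no radial renewal time of radius `≤ s` before
the end).  If `D` obeys the first-`A`-descent factorisation, is bounded by `K₀` at levels `≥ 1`,
contracts at one `A`-fold (`D(u;R u/A)[N] ≤ 1 - ε`) and has skip tail `≤ Cs B^{-κ}`, then
`D(u;r)[N] ≤ C (r/R u)^θ` for `1 ≤ r < R u`, with `θ > 0`, `C` depending only on
`A, ε, κ, Cs, K₀`.  Proof: `rr_decay_of_renewal_inequality` on `Site 2` at each fixed `N`, the
children being the prefixes of the factorisation. [folklore] -/
theorem rr_cd_abstract_chainDecay :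
    ∀ (A ε κ Cs K₀ x : ℝ), 1 < A → 0 < ε → 0 < κ → 0 ≤ x → ∃ θ C : ℝ, 0 < θ ∧ ∀ (S : ℕ → Finset (ℕ →
    Site 2)) (R : Site 2 → ℝ), (∀ (u : Site 2) (s : ℝ), s < R u / A → ∀ N : ℕ, (∑ n ∈ Finset.range
    (N + 1), ∑ _ω ∈ (S n).filter (fun ω => 0 < n ∧ (∀ i, 0 < i → i ≤ n → R (u + ω i) < R u) ∧ (∀ i,
    i < n → R (u + ω n) < R (u + ω i)) ∧ R (u + ω n) ≤ s ∧ (∀ t, 0 < t → t < n → (∀ i, i < t → R (u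
    + ω t) < R (u + ω i)) → (∀ j, t < j → j ≤ n → R (u + ω j) < R (u + ω t)) → s < R (u + ω t))), x
    ^ n) ≤ (∑ m ∈ Finset.range (N + 1), ∑ η ∈ (S m).filter (fun η => s < R (u + η m) ∧ 0 < m ∧ (∀ i,
    0 < i → i ≤ m → R (u + η i) < R u) ∧ (∀ i, i < m → R (u + η m) < R (u + η i)) ∧ R (u + η m) ≤ R
    u / A ∧ (∀ t, 0 < t → t < m → (∀ i, i < t → R (u + η t) < R (u + η i)) → (∀ j, t < j → j ≤ m → R
    (u + η j) < R (u + η t)) → R u / A < R (u + η t))), x ^ m * (∑ n ∈ Finset.range (N + 1), ∑ _ω ∈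
    (S n).filter (fun ω => 0 < n ∧ (∀ i, 0 < i → i ≤ n → R (u + η m + ω i) < R (u + η m)) ∧ (∀ i, i
    < n → R (u + η m + ω n) < R (u + η m + ω i)) ∧ R (u + η m + ω n) ≤ s ∧ (∀ t, 0 < t → t < n → (∀
    i, i < t → R (u + η m + ω t) < R (u + η m + ω i)) → (∀ j, t < j → j ≤ n → R (u + η m + ω j) < R
    (u + η m + ω t)) → s < R (u + η m + ω t))), x ^ n)) + (∑ n ∈ Finset.range (N + 1), ∑ _ω ∈ (S
    n).filter (fun ω => R (u + ω n) ≤ s ∧ 0 < n ∧ (∀ i, 0 < i → i ≤ n → R (u + ω i) < R u) ∧ (∀ i, i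
    < n → R (u + ω n) < R (u + ω i)) ∧ R (u + ω n) ≤ R u / A ∧ (∀ t, 0 < t → t < n → (∀ i, i < t → R
    (u + ω t) < R (u + ω i)) → (∀ j, t < j → j ≤ n → R (u + ω j) < R (u + ω t)) → R u / A < R (u + ω
    t))), x ^ n)) → (∀ (u : Site 2) (s : ℝ), 1 ≤ s → ∀ N : ℕ, (∑ n ∈ Finset.range (N + 1), ∑ _ω ∈ (S
    n).filter (fun ω => 0 < n ∧ (∀ i, 0 < i → i ≤ n → R (u + ω i) < R u) ∧ (∀ i, i < n → R (u + ω n)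
    < R (u + ω i)) ∧ R (u + ω n) ≤ s ∧ (∀ t, 0 < t → t < n → (∀ i, i < t → R (u + ω t) < R (u + ω
    i)) → (∀ j, t < j → j ≤ n → R (u + ω j) < R (u + ω t)) → s < R (u + ω t))), x ^ n) ≤ K₀) → (∀ (u
    : Site 2) (N : ℕ), (∑ n ∈ Finset.range (N + 1), ∑ _ω ∈ (S n).filter (fun ω => 0 < n ∧ (∀ i, 0 <
    i → i ≤ n → R (u + ω i) < R u) ∧ (∀ i, i < n → R (u + ω n) < R (u + ω i)) ∧ R (u + ω n) ≤ R u /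
    A ∧ (∀ t, 0 < t → t < n → (∀ i, i < t → R (u + ω t) < R (u + ω i)) → (∀ j, t < j → j ≤ n → R (u
    + ω j) < R (u + ω t)) → R u / A < R (u + ω t))), x ^ n) ≤ 1 - ε) → (∀ B : ℝ, 1 ≤ B → ∀ (u : Site
    2), A * B ≤ R u → ∀ N : ℕ, (∑ n ∈ Finset.range (N + 1), ∑ _ω ∈ (S n).filter (fun ω => R (u + ω
    n) ≤ R u / (A * B) ∧ 0 < n ∧ (∀ i, 0 < i → i ≤ n → R (u + ω i) < R u) ∧ (∀ i, i < n → R (u + ω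
    n) < R (u + ω i)) ∧ R (u + ω n) ≤ R u / A ∧ (∀ t, 0 < t → t < n → (∀ i, i < t → R (u + ω t) < R
    (u + ω i)) → (∀ j, t < j → j ≤ n → R (u + ω j) < R (u + ω t)) → R u / A < R (u + ω t))), x ^ n)
    ≤ Cs * B ^ (-κ)) → ∀ (u : Site 2) (r : ℝ), 1 ≤ r → r < R u → ∀ N : ℕ, (∑ n ∈ Finset.range (N +
    1), ∑ _ω ∈ (S n).filter (fun ω => 0 < n ∧ (∀ i, 0 < i → i ≤ n → R (u + ω i) < R u) ∧ (∀ i, i < n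
    → R (u + ω n) < R (u + ω i)) ∧ R (u + ω n) ≤ r ∧ (∀ t, 0 < t → t < n → (∀ i, i < t → R (u + ω t)
    < R (u + ω i)) → (∀ j, t < j → j ≤ n → R (u + ω j) < R (u + ω t)) → r < R (u + ω t))), x ^ n) ≤
    C * (r / R u) ^ θ := by
  intro A ε κ Cs K₀ x hA hε hκ hx
  obtain ⟨θ, C, hθ, key⟩ := rr_decay_of_renewal_inequality A ε κ Cs K₀ hA hε hκ
  refine ⟨θ, C, hθ, fun S R h4 h1 h2 h3 u r hr hrρ N => ?_⟩
  have hA0 : (0 : ℝ) < A := by linarith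
  refine key (Site 2) (Σ _ : ℕ, ℕ → Site 2) R
    (fun v s => ∑ n ∈ Finset.range (N + 1),
        ∑ _ω ∈ (S n).filter (fun ω =>
          0 < n ∧ (∀ i, 0 < i → i ≤ n → R (v + ω i) < R v) ∧
          (∀ i, i < n → R (v + ω n) < R (v + ω i)) ∧ R (v + ω n) ≤ s ∧
          (∀ t, 0 < t → t < n → (∀ i, i < t → R (v + ω t) < R (v + ω i)) →
            (∀ j, t < j → j ≤ n → R (v + ω j) < R (v + ω t)) → s < R (v + ω t))),
          x ^ n)
    (fun v s hs => h1 v s hs N) ?_ u r hr hrρ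
  -- the renewal step at a start `v` and a level `1 ≤ s < R v / A`
  intro v s hs hsA
  have hs0 : (0 : ℝ) < s := by linarith
  have hvA : s * A < R v := (lt_div_iff₀ hA0).1 hsA
  have hρ : 0 < R v := lt_of_le_of_lt (by positivity) hvA
  refine ⟨(Finset.range (N + 1)).sigma (fun m => (S m).filter (fun η =>
            s < R (v + η m) ∧
            0 < m ∧ (∀ i, 0 < i → i ≤ m → R (v + η i) < R v) ∧
            (∀ i, i < m → R (v + η m) < R (v + η i)) ∧ R (v + η m) ≤ R v / A ∧
            (∀ t, 0 < t → t < m → (∀ i, i < t → R (v + η t) < R (v + η i)) →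
              (∀ j, t < j → j ≤ m → R (v + η j) < R (v + η t)) → R v / A < R (v + η t)))),
    fun i => x ^ i.1, fun i => v + i.2 i.1, ?_, ?_, ?_, ?_, ?_⟩
  · -- nonnegative weights
    exact fun i _ => pow_nonneg hx _
  · -- the children land at radius `≤ R v / A`
    intro i hi
    simp only [Finset.mem_sigma, Finset.mem_filter] at hi
    exact hi.2.2.2.2.2.2.1
  · -- total weight `≤ D(v; R v/A)[N] ≤ 1 - ε` (death seed)
    rw [Finset.sum_sigma]
    refine le_trans (Finset.sum_le_sum fun m _ => ?_) (h2 v N)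
    refine Finset.sum_le_sum_of_subset_of_nonneg (fun η hη => ?_) fun _ _ _ => pow_nonneg hx _
    rw [Finset.mem_filter] at hη ⊢
    exact ⟨hη.1, hη.2.2⟩
  · -- band masses are skip masses (skip tail)
    intro B hB hAB
    have hsk := h3 B hB v hAB N
    rw [Finset.sum_sigma'] at hsk
    refine le_trans (Finset.sum_le_sum_of_subset_of_nonneg (fun i hi => ?_)
      fun i _ _ => pow_nonneg hx _) hsk
    simp only [Finset.mem_filter, Finset.mem_sigma] at hi ⊢
    exact ⟨hi.1.1, hi.1.2.1, hi.2, hi.1.2.2.2⟩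
  · -- the factorisation, with the skip term bounded by the skip tail at `B = R v/(A s)`
    have hB1 : (1 : ℝ) ≤ R v / (A * s) := by
      rw [le_div_iff₀ (by positivity)]
      linarith
    have hAB : A * (R v / (A * s)) ≤ R v := by
      rw [show A * (R v / (A * s)) = R v / s by field_simp]
      exact div_le_self hρ.le hs
    have hsk := h3 _ hB1 v hAB N
    have e : R v / (A * (R v / (A * s))) = s := by
      field_simp
    rw [e] at hsk
    refine (h4 v s hsA N).trans (add_le_add (le_of_eq ?_) hsk)
    rw [Finset.sum_sigma]

/-- **S5 · `stub_chainDecay`** — the renewal-inequality induction of the line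
`radial-renewal-kesten-inequality` (crux `AnnularMassDecay`, stmt-CriticalPhenomena-4729), registered
verbatim: first-descent factorisation → chain boundedness → death seed → skip tail → `ChainDecay`
(`∃ θ > 0, C` with `D(u;r)[N] ≤ C (r/ρ_u)^θ` for `1 ≤ r < ρ_u`).  Proof: `rr_cd_abstract_chainDecay`
with `S = SAW.Zd.saws 2`, `x = SAW.criticalFugacity`, and, centre by centre, `R = dist (Site.toComplex ·) z`. -/
theorem stub_chainDecay :
    (∀ A : ℝ, 1 < A → ∀ (z : ℂ) (u : Site 2) (s : ℝ), s < dist (Site.toComplex u) z / A → ∀ N : ℕ,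
      (∑ n ∈ Finset.range (N + 1),
        ∑ _ω ∈ (SAW.Zd.saws 2 n).filter (fun ω =>
          0 < n ∧
          (∀ i, 0 < i → i ≤ n → dist (Site.toComplex (u + ω i)) z < dist (Site.toComplex u) z) ∧
          (∀ i, i < n → dist (Site.toComplex (u + ω n)) z < dist (Site.toComplex (u + ω i)) z) ∧
          dist (Site.toComplex (u + ω n)) z ≤ s ∧
          (∀ t, 0 < t → t < n →
            (∀ i, i < t → dist (Site.toComplex (u + ω t)) z < dist (Site.toComplex (u + ω i)) z) →
            (∀ j, t < j → j ≤ n → dist (Site.toComplex (u + ω j)) z < dist (Site.toComplex (u + ω t)) z) →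
            s < dist (Site.toComplex (u + ω t)) z)),
          SAW.criticalFugacity ^ n) ≤
      (∑ m ∈ Finset.range (N + 1),
        ∑ η ∈ (SAW.Zd.saws 2 m).filter (fun η =>
            s < dist (Site.toComplex (u + η m)) z ∧
            0 < m ∧
            (∀ i, 0 < i → i ≤ m → dist (Site.toComplex (u + η i)) z < dist (Site.toComplex u) z) ∧
            (∀ i, i < m → dist (Site.toComplex (u + η m)) z < dist (Site.toComplex (u + η i)) z) ∧
            dist (Site.toComplex (u + η m)) z ≤ dist (Site.toComplex u) z / A ∧
            (∀ t, 0 < t → t < m →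
              (∀ i, i < t → dist (Site.toComplex (u + η t)) z < dist (Site.toComplex (u + η i)) z) →
              (∀ j, t < j → j ≤ m → dist (Site.toComplex (u + η j)) z < dist (Site.toComplex (u + η t)) z) →
              dist (Site.toComplex u) z / A < dist (Site.toComplex (u + η t)) z)),
          SAW.criticalFugacity ^ m *
            (∑ n ∈ Finset.range (N + 1),
                ∑ _ω ∈ (SAW.Zd.saws 2 n).filter (fun ω =>
                  0 < n ∧
                  (∀ i, 0 < i → i ≤ n → dist (Site.toComplex (u + η m + ω i)) z < dist (Site.toComplex (u + η m)) z) ∧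
                  (∀ i, i < n → dist (Site.toComplex (u + η m + ω n)) z < dist (Site.toComplex (u + η m + ω i)) z) ∧
                  dist (Site.toComplex (u + η m + ω n)) z ≤ s ∧
                  (∀ t, 0 < t → t < n →
                    (∀ i, i < t → dist (Site.toComplex (u + η m + ω t)) z < dist (Site.toComplex (u + η m + ω i)) z) →
                    (∀ j, t < j → j ≤ n → dist (Site.toComplex (u + η m + ω j)) z < dist (Site.toComplex (u + η m + ω t)) z) →
                    s < dist (Site.toComplex (u + η m + ω t)) z)),
                  SAW.criticalFugacity ^ n)) +
      (∑ n ∈ Finset.range (N + 1),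
        ∑ _ω ∈ (SAW.Zd.saws 2 n).filter (fun ω =>
          dist (Site.toComplex (u + ω n)) z ≤ s ∧
          0 < n ∧
          (∀ i, 0 < i → i ≤ n → dist (Site.toComplex (u + ω i)) z < dist (Site.toComplex u) z) ∧
          (∀ i, i < n → dist (Site.toComplex (u + ω n)) z < dist (Site.toComplex (u + ω i)) z) ∧
          dist (Site.toComplex (u + ω n)) z ≤ dist (Site.toComplex u) z / A ∧
          (∀ t, 0 < t → t < n →
            (∀ i, i < t → dist (Site.toComplex (u + ω t)) z < dist (Site.toComplex (u + ω i)) z) →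
            (∀ j, t < j → j ≤ n → dist (Site.toComplex (u + ω j)) z < dist (Site.toComplex (u + ω t)) z) →
            dist (Site.toComplex u) z / A < dist (Site.toComplex (u + ω t)) z)),
          SAW.criticalFugacity ^ n)) →
    (∃ K₀ : ℝ, ∀ (z : ℂ) (u : Site 2) (s : ℝ), 1 ≤ s → ∀ N : ℕ,
      (∑ n ∈ Finset.range (N + 1),
        ∑ _ω ∈ (SAW.Zd.saws 2 n).filter (fun ω =>
          0 < n ∧
          (∀ i, 0 < i → i ≤ n → dist (Site.toComplex (u + ω i)) z < dist (Site.toComplex u) z) ∧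
          (∀ i, i < n → dist (Site.toComplex (u + ω n)) z < dist (Site.toComplex (u + ω i)) z) ∧
          dist (Site.toComplex (u + ω n)) z ≤ s ∧
          (∀ t, 0 < t → t < n →
            (∀ i, i < t → dist (Site.toComplex (u + ω t)) z < dist (Site.toComplex (u + ω i)) z) →
            (∀ j, t < j → j ≤ n → dist (Site.toComplex (u + ω j)) z < dist (Site.toComplex (u + ω t)) z) →
            s < dist (Site.toComplex (u + ω t)) z)),
          SAW.criticalFugacity ^ n) ≤ K₀) →
    (∃ A ε : ℝ, 1 < A ∧ 0 < ε ∧ ∀ (z : ℂ) (u : Site 2) (N : ℕ),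
      (∑ n ∈ Finset.range (N + 1),
        ∑ _ω ∈ (SAW.Zd.saws 2 n).filter (fun ω =>
          0 < n ∧
          (∀ i, 0 < i → i ≤ n → dist (Site.toComplex (u + ω i)) z < dist (Site.toComplex u) z) ∧
          (∀ i, i < n → dist (Site.toComplex (u + ω n)) z < dist (Site.toComplex (u + ω i)) z) ∧
          dist (Site.toComplex (u + ω n)) z ≤ dist (Site.toComplex u) z / A ∧
          (∀ t, 0 < t → t < n →
            (∀ i, i < t → dist (Site.toComplex (u + ω t)) z < dist (Site.toComplex (u + ω i)) z) →
            (∀ j, t < j → j ≤ n → dist (Site.toComplex (u + ω j)) z < dist (Site.toComplex (u + ω t)) z) →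
            dist (Site.toComplex u) z / A < dist (Site.toComplex (u + ω t)) z)),
          SAW.criticalFugacity ^ n) ≤ 1 - ε) →
    (∀ A : ℝ, 1 < A → ∃ κ C : ℝ, 0 < κ ∧ ∀ B : ℝ, 1 ≤ B → ∀ (z : ℂ) (u : Site 2),
      A * B ≤ dist (Site.toComplex u) z → ∀ N : ℕ,
      (∑ n ∈ Finset.range (N + 1),
        ∑ _ω ∈ (SAW.Zd.saws 2 n).filter (fun ω =>
          dist (Site.toComplex (u + ω n)) z ≤ dist (Site.toComplex u) z / (A * B) ∧
          0 < n ∧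
          (∀ i, 0 < i → i ≤ n → dist (Site.toComplex (u + ω i)) z < dist (Site.toComplex u) z) ∧
          (∀ i, i < n → dist (Site.toComplex (u + ω n)) z < dist (Site.toComplex (u + ω i)) z) ∧
          dist (Site.toComplex (u + ω n)) z ≤ dist (Site.toComplex u) z / A ∧
          (∀ t, 0 < t → t < n →
            (∀ i, i < t → dist (Site.toComplex (u + ω t)) z < dist (Site.toComplex (u + ω i)) z) →
            (∀ j, t < j → j ≤ n → dist (Site.toComplex (u + ω j)) z < dist (Site.toComplex (u + ω t)) z) →
            dist (Site.toComplex u) z / A < dist (Site.toComplex (u + ω t)) z)),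
          SAW.criticalFugacity ^ n) ≤ C * B ^ (-κ)) →
    ∃ θ C : ℝ, 0 < θ ∧ ∀ (z : ℂ) (u : Site 2) (r : ℝ), 1 ≤ r → r < dist (Site.toComplex u) z → ∀ N : ℕ,
      (∑ n ∈ Finset.range (N + 1),
        ∑ _ω ∈ (SAW.Zd.saws 2 n).filter (fun ω =>
          0 < n ∧
          (∀ i, 0 < i → i ≤ n → dist (Site.toComplex (u + ω i)) z < dist (Site.toComplex u) z) ∧
          (∀ i, i < n → dist (Site.toComplex (u + ω n)) z < dist (Site.toComplex (u + ω i)) z) ∧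
          dist (Site.toComplex (u + ω n)) z ≤ r ∧
          (∀ t, 0 < t → t < n →
            (∀ i, i < t → dist (Site.toComplex (u + ω t)) z < dist (Site.toComplex (u + ω i)) z) →
            (∀ j, t < j → j ≤ n → dist (Site.toComplex (u + ω j)) z < dist (Site.toComplex (u + ω t)) z) →
            r < dist (Site.toComplex (u + ω t)) z)),
          SAW.criticalFugacity ^ n) ≤ C * (r / dist (Site.toComplex u) z) ^ θ := by
  intro h4 h1 h2 h3
  obtain ⟨K₀, hK₀⟩ := h1
  obtain ⟨A, ε, hA, hε, hseed⟩ := h2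
  obtain ⟨κ, Cs, hκ, hskip⟩ := h3 A hA
  obtain ⟨θ, C, hθ, key⟩ :=
    rr_cd_abstract_chainDecay A ε κ Cs K₀ SAW.criticalFugacity hA hε hκ criticalFugacity_pos.le
  exact ⟨θ, C, hθ, fun z u r hr hrρ N =>
    key (SAW.Zd.saws 2) (fun v => dist (Site.toComplex v) z) (h4 A hA z) (hK₀ z) (hseed z)
      (fun B hB v => hskip B hB z v) u r hr hrρ N⟩

end Summit.CriticalPhenomena.SAWScalingLimit.Theorems.AnnularMassDecay.Radial

end
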